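import Literature.NumberTheory.EllipticCurves.WeierstrassAddLawTwoMinor
import Mathlib.AlgebraicGeometry.EllipticCurve.Projective.Point
import HarnessLib

/-!
# The two addition laws form a complete system (field-valued points)

For a Weierstrass curve `W` over a field `F` and *nonsingular* point representatives `P, Q`
(Mathlib `WeierstrassCurve.Projective.Nonsingular`), Mathlib's bidegree-`(2, 2)` law
`addXYZ P Q` and the second law `add₂XYZ P Q` of `EllipticCurves/WeierstrassAddLawTwo` satisfy:

* `addXYZ_eq_zero_of_equiv` / `addXYZ_ne_zero_of_not_equiv`: `addXYZ P Q = 0` iff `P ≈ Q`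
  (Mathlib: `addXYZ_self`, `add_of_not_equiv`, `nonsingular_add`);
* `add₂XYZ_ne_zero_of_equiv`: `add₂XYZ P Q ≠ 0` when `P ≈ Q` (it is `u² • dblXYZ P`,
  `add₂XYZ_self`, and `dblXYZ P` is nonsingular);
* hence **completeness** (`addXYZ_ne_zero_or_add₂XYZ_ne_zero`): at every pair of nonsingular
  points one of the two laws is non-zero — Bosma–Lenstra (1995), Theorem 2 ("the two addition
  laws corresponding to `(0 : 0 : 1)` and `(0 : 1 : 0)` form a complete system");
* and **both laws compute the group law where they are non-zero**: `addXYZ P Q = W.add P Q`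
  when `addXYZ P Q ≠ 0` (`addXYZ_eq_add`), and `add₂XYZ P Q ≈ W.add P Q` when `add₂XYZ P Q ≠ 0`
  (`add₂XYZ_equiv_add`: on the diagonal via `dblXYZ`, off it via the three vanishing minors of
  `…Proportional` / `…Minor` and `equiv_of_cross_mul_eq`), where `W.add` is Mathlib's
  representative of `⟦P⟧ + ⟦Q⟧` (`WeierstrassCurve.Projective.addMap_eq`).

These are exactly the pointwise facts needed to see that the morphism `E × E → E` glued from the
two laws restricts to Mathlib's group law on field-valued points (Silverman, *AEC*, III.3.6).

## References

* [BosmaLenstra1995] W. Bosma, H. W. Lenstra, J. Number Theory 53 (1995): Theorem 2.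
* [SilvermanAEC2009] J. H. Silverman, *AEC*, 2nd ed.: III.2 (group law), III.3.6.

## Design notes

All declarations are deliberate dot-notation extensions of Mathlib's
`namespace WeierstrassCurve.Projective` (they concern Mathlib's `addXYZ`, `add`, `Nonsingular`),
with the local notations `x y z` of Mathlib's projective files.
-/

local notation3 "x" => (0 : Fin 3)

local notation3 "y" => (1 : Fin 3)

local notation3 "z" => (2 : Fin 3)

universe u

open scoped WeierstrassCurve.Projective

namespace WeierstrassCurve.Projective

variable {F : Type u} [Field F] {W : Projective F}

/-! ### Proportionality of vectors from vanishing minors -/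

/-- Two non-zero vectors of `F³` all of whose `2 × 2` minors vanish are proportional by a unit
(i.e. equivalent as point representatives). [folklore] -/
theorem equiv_of_cross_mul_eq {u v : Fin 3 → F} (hu : u ≠ 0) (hv : v ≠ 0)
    (h : ∀ i j : Fin 3, u i * v j = u j * v i) : u ≈ v := by
  obtain ⟨i₀, hi₀⟩ := Function.ne_iff.mp hv
  have hi₀ : v i₀ ≠ 0 := by simpa using hi₀
  have hui₀ : u i₀ ≠ 0 := by
    intro hu0
    apply hu
    funext j
    have := h j i₀
    rw [hu0, zero_mul] at this
    exact (mul_eq_zero.mp this).resolve_right hi₀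
  refine ⟨Units.mk0 (u i₀ / v i₀) (div_ne_zero hui₀ hi₀), ?_⟩
  funext j
  change (Units.mk0 (u i₀ / v i₀) (div_ne_zero hui₀ hi₀)) • v j = u j
  rw [Units.smul_def, Units.val_mk0, smul_eq_mul, div_mul_eq_mul_div, div_eq_iff hi₀, ← h j i₀]

/-! ### Where Mathlib's law vanishes -/

/-- `addXYZ P Q = 0` when `P ≈ Q` (bihomogeneity and `addXYZ_self`). [folklore] -/
theorem addXYZ_eq_zero_of_equiv {P Q : Fin 3 → F} (h : P ≈ Q) : W.addXYZ P Q = 0 := by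
  obtain ⟨u, rfl⟩ := h
  change W.addXYZ (u • Q) Q = 0
  rw [Units.smul_def, show W.addXYZ ((u : F) • Q) Q = W.addXYZ ((u : F) • Q) ((1 : F) • Q) by
    rw [one_smul], addXYZ_smul, addXYZ_self]
  ext i
  fin_cases i <;> simp

/-- For nonsingular `P ≉ Q`, `addXYZ P Q` is Mathlib's representative of `P + Q`, hence
nonsingular and in particular non-zero. [folklore] -/
theorem addXYZ_ne_zero_of_not_equiv {P Q : Fin 3 → F} (hP : W.Nonsingular P)
    (hQ : W.Nonsingular Q) (h : ¬ P ≈ Q) : W.addXYZ P Q ≠ 0 := by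
  rw [← add_of_not_equiv h]
  intro h0
  have hns := nonsingular_add hP hQ
  rw [h0, nonsingular_iff] at hns
  simp at hns

/-- `addXYZ P Q ≠ 0` forces `P ≉ Q`, so `addXYZ P Q = W.add P Q`. [folklore] -/
theorem addXYZ_eq_add {P Q : Fin 3 → F} (h : W.addXYZ P Q ≠ 0) : W.addXYZ P Q = W.add P Q := by
  have hne : ¬ P ≈ Q := fun hPQ => h (addXYZ_eq_zero_of_equiv hPQ)
  rw [add_of_not_equiv hne]

/-! ### Where the second law does not vanish -/

/-- `dblXYZ P ≠ 0` for nonsingular `P` (it represents `2P`). [folklore] -/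
theorem dblXYZ_ne_zero {P : Fin 3 → F} (hP : W.Nonsingular P) : W.dblXYZ P ≠ 0 := by
  intro h0
  have hns := nonsingular_add hP hP
  rw [add_self, h0, nonsingular_iff] at hns
  simp at hns

/-- On equivalent representatives the second law is a unit multiple of the doubling law:
`add₂XYZ (u • Q) Q = u² • dblXYZ Q` for `Q` on the curve. [cite: BosmaLenstra1995, Theorem 2] -/
theorem add₂XYZ_smul_self {Q : Fin 3 → F} (hQ : W.Equation Q) (u : F) :
    W.add₂XYZ (u • Q) Q = u ^ 2 • W.dblXYZ Q := by
  rw [show W.add₂XYZ (u • Q) Q = W.add₂XYZ (u • Q) ((1 : F) • Q) by rw [one_smul], add₂XYZ_smul,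
    add₂XYZ_self hQ, mul_one]

/-- **The second law does not vanish on the diagonal**: `add₂XYZ P Q ≠ 0` for nonsingular
`P ≈ Q`. [cite: BosmaLenstra1995, Theorem 2] -/
theorem add₂XYZ_ne_zero_of_equiv {P Q : Fin 3 → F} (hQ : W.Nonsingular Q) (h : P ≈ Q) :
    W.add₂XYZ P Q ≠ 0 := by
  obtain ⟨u, rfl⟩ := h
  change W.add₂XYZ (u • Q) Q ≠ 0
  rw [Units.smul_def, add₂XYZ_smul_self hQ.1]
  exact smul_ne_zero (pow_ne_zero 2 u.ne_zero) (dblXYZ_ne_zero hQ)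

/-- **Completeness of the system of two addition laws** (Bosma–Lenstra 1995, Theorem 2): at every
pair of nonsingular point representatives, `addXYZ P Q ≠ 0` or `add₂XYZ P Q ≠ 0`.
[cite: BosmaLenstra1995, Theorem 2] -/
theorem addXYZ_ne_zero_or_add₂XYZ_ne_zero {P Q : Fin 3 → F} (hP : W.Nonsingular P)
    (hQ : W.Nonsingular Q) : W.addXYZ P Q ≠ 0 ∨ W.add₂XYZ P Q ≠ 0 := by
  by_cases h : P ≈ Q
  · exact Or.inr (add₂XYZ_ne_zero_of_equiv hQ h)
  · exact Or.inl (addXYZ_ne_zero_of_not_equiv hP hQ h)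

/-! ### Both laws compute the group law -/

/-- **Where the second law is non-zero it represents `P + Q`**: `add₂XYZ P Q ≈ W.add P Q` for
nonsingular `P, Q` with `add₂XYZ P Q ≠ 0` (on the diagonal both are unit multiples of `dblXYZ`;
off it, `W.add P Q = addXYZ P Q ≠ 0` and all `2 × 2` minors of the two laws vanish).
[cite: BosmaLenstra1995, Theorem 2] -/
theorem add₂XYZ_equiv_add {P Q : Fin 3 → F} (hP : W.Nonsingular P) (hQ : W.Nonsingular Q)
    (h2 : W.add₂XYZ P Q ≠ 0) : W.add₂XYZ P Q ≈ W.add P Q := by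
  by_cases h : P ≈ Q
  · rw [add_of_equiv h]
    obtain ⟨u, rfl⟩ := h
    -- `add₂XYZ (u • Q) Q = u² • dblXYZ Q` and `dblXYZ (u • Q) = u⁴ • dblXYZ Q`
    change W.add₂XYZ (u • Q) Q ≈ W.dblXYZ (u • Q)
    rw [Units.smul_def, add₂XYZ_smul_self hQ.1, dblXYZ_smul]
    exact (smul_equiv_smul (W.dblXYZ Q) (W.dblXYZ Q) (pow_ne_zero 2 u.ne_zero).isUnit
      (pow_ne_zero 4 u.ne_zero).isUnit).mpr (Setoid.refl _)
  · rw [add_of_not_equiv h]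
    have h1 : W.addXYZ P Q ≠ 0 := addXYZ_ne_zero_of_not_equiv hP hQ h
    refine equiv_of_cross_mul_eq h2 h1 fun i j => ?_
    have mXZ := add₂X_mul_addZ hP.1 hQ.1
    have mYZ := add₂Y_mul_addZ hP.1 hQ.1
    have mXY := add₂X_mul_addY' hP.1 hQ.1
    fin_cases i <;> fin_cases j
    · rfl
    · simpa [add₂XYZ, addXYZ] using mXY
    · simpa [add₂XYZ, addXYZ] using mXZ
    · simpa [add₂XYZ, addXYZ] using mXY.symm
    · rfl
    · simpa [add₂XYZ, addXYZ] using mYZ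
    · simpa [add₂XYZ, addXYZ] using mXZ.symm
    · simpa [add₂XYZ, addXYZ] using mYZ.symm
    · rfl

/-- The class of the second law, where non-zero, is `⟦P⟧ + ⟦Q⟧` computed by Mathlib's `addMap`.
[cite: BosmaLenstra1995, Theorem 2] -/
theorem addMap_eq_add₂XYZ {P Q : Fin 3 → F} (hP : W.Nonsingular P) (hQ : W.Nonsingular Q)
    (h2 : W.add₂XYZ P Q ≠ 0) : W.addMap ⟦P⟧ ⟦Q⟧ = ⟦W.add₂XYZ P Q⟧ := by
  rw [addMap_eq]
  exact (Quotient.sound (add₂XYZ_equiv_add hP hQ h2)).symm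

/-- The class of Mathlib's law, where non-zero, is `⟦P⟧ + ⟦Q⟧`. [folklore] -/
theorem addMap_eq_addXYZ {P Q : Fin 3 → F} (h1 : W.addXYZ P Q ≠ 0) :
    W.addMap ⟦P⟧ ⟦Q⟧ = ⟦W.addXYZ P Q⟧ := by
  rw [addMap_eq, addXYZ_eq_add h1]

end WeierstrassCurve.Projective
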